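import Summits.CriticalPhenomena.Ising3DConformalLimit.Theorems.InverseSquareTelemetryEtaBoundsFromTelemetry
import HarnessLib

/-!
# Crux `PositiveSolutionAsymptotics` (stmt-CriticalPhenomena-4496), stub `stub_aprioriBounds` (S1):
# a-priori two-sided bounds for positive solutions of `Δ_{ℤ³} u = V u` far out

THEOREM-ONLY file (no definitions, no named facts), `--supports stmt-CriticalPhenomena-4496`.

Let `u, V : ℤ³ → ℝ`, `R`, `κ ≥ 0`, `ε > 0`, `C` with, on `{|x|₂ ≥ R}` (`|x|₂ = √s`, `s = ∑ᵢ xᵢ²`):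
`u > 0`, `Δ_{ℤ³} u = V u` (six-neighbour Laplacian, inlined) and `|s V - κ| ≤ C √s^{-ε}`; and `u → 0`
cofinitely. Put `p = (1 + √(1+4κ))/4` (`2p = α₊(κ)`, `2p(2p-1) = κ`). Contents:
* `weight_arith_one_add`: the pointwise arithmetic making the NON-decaying weight `h = 1 + s^{-t}` a
  supersolution of `Δ - V` far out (`0 < t < e = ε/2`, `t < 1/2`): `Δ s^{-t} ≈ -2t(1-2t) s^{-t-1} < 0`
  beats `-V h ≤ C s^{-e-1} h`;
* `exterior_region_aux`, `upper_comparison_of_barrier`, `lower_comparison_of_barrier`: on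
  `E_T = {T ≤ s}` (`T ≥ S₀ ≥ 64`, `∂E_T ⊆ {T/4 ≤ s < T}`) boundary domination `u ≤ K w₊` (resp.
  `k w₋ ≤ u`) propagates inside, by the tree's `h`-transform comparison principle
  `sub_le_super_of_hTransform` with the weight `h`, whose decay hypothesis `u - K w₊ = o(h)` IS `u → 0`
  (the tree's `EtaBoundsFromTelemetry.exterior_bounds` used `h = s^{-1/4}`, `G = O(s^{-1/2})` instead);
* `exterior_comparison`: constants `S₀ ≥ 64` (`R² ≤ S₀/4`), `A > 0`, `e' > 0` such that for EVERY
  `T ≥ S₀` the barriers `w± = s^{-p} ∓ A s^{-(p+e')}` (`latticeLaplacianZd_rpow_neg`, `barrier_arith`, as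
  in `exterior_bounds`) and `h = 1 + s^{-e'}` do this on `E_T`, and `A s^{-e'} ≤ 1/2` for `s ≥ T/4`;
* `stub_aprioriBounds` (registered stub S1, verbatim): `0 < m ≤ u(x)|x|₂^{α₊} ≤ M` cofinitely (`T = S₀`;
  `M`, `m` from the finite shell `∂E_{S₀}` by `exists_le_mul_on_finite` and `u > 0` on `{s ≥ R²}`).

References: Murata, Duke Math. J. 53 (1986); Pinchover, J. Differential Equations 111 (1994);
Keller–Pinchover–Pogorzelski, J. Spectral Theory 10 (2020) §4.2 (positive solutions on graphs).
-/

noncomputable section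

namespace Summit.CriticalPhenomena.Ising3DConformalLimit.Theorems.PositiveSolutionAsymptotics

open Literature.Probability.LatticeModels Finset Set Filter Topology
open Summit.CriticalPhenomena.Ising3DConformalLimit.Theorems.EtaBoundsFromTelemetry

/-- **Weight arithmetic for `h = 1 + s^{-t}`** at one point: with the lattice Taylor expansion
`|L_t - 2t(2t-1) s^{-t-1}| ≤ K_t s^{-t-3/2}` of `L_t = Δ s^{-t}`, the telemetry bound
`|sV - κ| ≤ C s^{-e}` (`κ ≥ 0`) and the smallness `K_t s^{-1/2} + C s^{t-e} + C s^{-e} ≤ 2t(1-2t)`,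
one has `L_t ≤ V (s^{-t} + 1)`, i.e. `Δ h ≤ V h` for `h = 1 + s^{-t}` (`Δ 1 = 0`). -/
theorem weight_arith_one_add {s e t κ C Kt Lt V : ℝ} (hs : 1 ≤ s) (hκ : 0 ≤ κ)
    (hLt : |Lt - 2 * t * (2 * t - 1) * s ^ (-t - 1)| ≤ Kt * s ^ (-t - 3 / 2))
    (hV : |s * V - κ| ≤ C * s ^ (-e))
    (hsmall : Kt * s ^ (-(1 / 2 : ℝ)) + C * s ^ (t - e) + C * s ^ (-e) ≤ 2 * t * (1 - 2 * t)) :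
    Lt ≤ V * (s ^ (-t) + 1) := by
  have s0 : 0 < s := by linarith
  have hpow : ∀ a b : ℝ, s ^ a * s ^ b = s ^ (a + b) := fun a b => (Real.rpow_add s0 a b).symm
  set H : ℝ := s ^ (-t - 1) with hH
  set w : ℝ := s ^ t with hw
  have hH0 : 0 < H := Real.rpow_pos_of_pos s0 _
  have hw0 : 0 < w := Real.rpow_pos_of_pos s0 _
  have e2 : s ^ (-t - 3 / 2) = s ^ (-(1 / 2 : ℝ)) * H := by rw [hH, hpow]; congr 1; ring
  have e4 : s ^ (-t) = s * H := by
    calc s ^ (-t) = s ^ ((1 : ℝ) + (-t - 1)) := by congr 1; ring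
      _ = s * H := by rw [Real.rpow_add s0, Real.rpow_one]
  have e5 : s * (w * H) = 1 := by
    rw [hw, hH, hpow, show t + (-t - 1) = (-1 : ℝ) by ring, Real.rpow_neg_one,
      mul_inv_cancel₀ s0.ne']
  have e6 : s ^ (t - e) = s ^ (-e) * w := by rw [hw, hpow]; congr 1; ring
  rw [e2] at hLt
  rw [e6] at hsmall
  have key : s * V * ((w + 1) * H) = V * (s * H + 1) := by linear_combination V * e5
  rw [e4, ← key]
  obtain ⟨hW1, -⟩ := abs_le.1 hV
  obtain ⟨-, hL2⟩ := abs_le.1 hLt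
  have f1 : (κ - C * s ^ (-e)) * ((w + 1) * H) ≤ s * V * ((w + 1) * H) :=
    mul_le_mul_of_nonneg_right (by linarith) (by positivity)
  have f2 : H * (Kt * s ^ (-(1 / 2 : ℝ)) + C * (s ^ (-e) * w) + C * s ^ (-e)) ≤
      H * (2 * t * (1 - 2 * t)) := mul_le_mul_of_nonneg_left hsmall hH0.le
  have f3 : 0 ≤ κ * ((w + 1) * H) := by positivity
  linarith [f1, f2, f3, hL2]

/-- Bookkeeping on the exterior region `E_T = {T ≤ s}` (`64 ≤ S₀ ≤ T`, `s = ∑ xᵢ²` as a function `S`):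
`E_T ∪ ∂E_T ⊆ {S₀/4 ≤ s}` (`sumSq_of_mem_zdOuterBoundary`), and the weight `s^{-e'} + 1 ≥ 1` is
positive there. -/
theorem exterior_region_aux {S : Site 3 → ℝ} (hS : ∀ x, S x = ∑ i, ((x i : ℤ) : ℝ) ^ 2)
    {S₀ T : ℝ} (e' : ℝ) (hS₀ : 64 ≤ S₀) (hT : S₀ ≤ T) :
    (∀ x ∈ {y : Site 3 | T ≤ S y} ∪ zdOuterBoundary {y : Site 3 | T ≤ S y}, S₀ / 4 ≤ S x) ∧
      (∀ x : Site 3, 1 ≤ S x ^ (-e') + 1) ∧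
      ∀ x ∈ {y : Site 3 | T ≤ S y} ∪ zdOuterBoundary {y : Site 3 | T ≤ S y}, 0 < S x ^ (-e') + 1 := by
  have hh1 : ∀ z : Site 3, 1 ≤ S z ^ (-e') + 1 := fun z => by
    have h0 : 0 ≤ S z := by rw [hS]; positivity
    linarith [Real.rpow_nonneg h0 (-e')]
  refine ⟨fun z hz => ?_, hh1, fun z _ => by linarith [hh1 z]⟩
  rcases hz with hz | hz
  · exact le_trans (by linarith) (show T ≤ S z from hz)
  · have hz' : z ∈ zdOuterBoundary {x : Site 3 | T ≤ ∑ i, ((x i : ℤ) : ℝ) ^ 2} := by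
      simpa only [hS] using hz
    have h := (sumSq_of_mem_zdOuterBoundary (le_trans hS₀ hT) hz').1
    rw [← hS] at h
    linarith

/-- **Upper comparison on an exterior region.** Let `64 ≤ S₀ ≤ T` and suppose that for `s ≥ S₀/4`:
`h = s^{-e'} + 1` and `w₊ = s^{-p} - A s^{-(p+e')} > 0` are supersolutions of `Δ - V` and `Δu = Vu`;
let `u → 0` cofinitely. If `u ≤ K w₊` (`K ≥ 0`) on `∂E_T`, `E_T = {T ≤ s}`, then `u ≤ K w₊` on `E_T`
(`sub_le_super_of_hTransform`; decay `u - K w₊ ≤ u ≤ δ ≤ δ h` cofinitely). -/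
theorem upper_comparison_of_barrier {S u V : Site 3 → ℝ}
    (hS : ∀ x, S x = ∑ i, ((x i : ℤ) : ℝ) ^ 2) {S₀ T p e' A K : ℝ} (hS₀ : 64 ≤ S₀) (hT : S₀ ≤ T)
    (hK : 0 ≤ K)
    (hsuper : ∀ x : Site 3, S₀ / 4 ≤ S x →
      latticeLaplacianZd (fun y => S y ^ (-e') + 1) x ≤ V x * (S x ^ (-e') + 1))
    (hbar : ∀ x : Site 3, S₀ / 4 ≤ S x →
      latticeLaplacianZd (fun y => S y ^ (-p) - A * S y ^ (-(p + e'))) x ≤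
        V x * (S x ^ (-p) - A * S x ^ (-(p + e'))))
    (hwpos : ∀ x : Site 3, S₀ / 4 ≤ S x → 0 < S x ^ (-p) - A * S x ^ (-(p + e')))
    (hsol : ∀ x : Site 3, S₀ / 4 ≤ S x → latticeLaplacianZd u x = V x * u x)
    (hu0 : Tendsto u cofinite (𝓝 0))
    (hbdry : ∀ y ∈ zdOuterBoundary {x : Site 3 | T ≤ S x},
      u y ≤ K * (S y ^ (-p) - A * S y ^ (-(p + e'))))
    {x : Site 3} (hx : T ≤ S x) : u x ≤ K * (S x ^ (-p) - A * S x ^ (-(p + e'))) := by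
  obtain ⟨hEadm, hh1, hpos⟩ := exterior_region_aux hS e' hS₀ hT
  refine sub_le_super_of_hTransform (d := 3) (by norm_num) (E := {y : Site 3 | T ≤ S y}) (V := V)
    (u := u) (w := fun y => K * (S y ^ (-p) - A * S y ^ (-(p + e'))))
    (h := fun y => S y ^ (-e') + 1) hpos (fun z hz => hsuper z (hEadm z (Or.inl hz)))
    (fun y hy => by rw [hsol y (hEadm y (Or.inl hy))]) (fun y hy => ?_) hbdry (fun δ hδ => ?_) x hx
  · rw [latticeLaplacianZd_const_mul]
    calc K * latticeLaplacianZd (fun z => S z ^ (-p) - A * S z ^ (-(p + e'))) y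
        ≤ K * (V y * (S y ^ (-p) - A * S y ^ (-(p + e')))) :=
          mul_le_mul_of_nonneg_left (hbar y (hEadm y (Or.inl hy))) hK
      _ = V y * (K * (S y ^ (-p) - A * S y ^ (-(p + e')))) := by ring
  · filter_upwards [hu0.eventually (eventually_le_nhds hδ)] with y hy hyE
    have h0 : 0 ≤ K * (S y ^ (-p) - A * S y ^ (-(p + e'))) :=
      mul_nonneg hK (hwpos y (hEadm y (Or.inl hyE))).le
    calc u y - K * (S y ^ (-p) - A * S y ^ (-(p + e'))) ≤ δ := by linarith
      _ ≤ δ * (S y ^ (-e') + 1) := le_mul_of_one_le_right hδ.le (hh1 y)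

/-- **Lower comparison on an exterior region.** Let `64 ≤ S₀ ≤ T` and suppose that for `s ≥ S₀/4`:
`h = s^{-e'} + 1` is a supersolution and `w₋ = s^{-p} + A s^{-(p+e')} ≤ 2 s^{-1/2}` a subsolution of
`Δ - V`, `Δu = Vu` and `u > 0`. If `k w₋ ≤ u` (`k ≥ 0`) on `∂E_T`, `E_T = {T ≤ s}`, then `k w₋ ≤ u` on
`E_T` (`sub_le_super_of_hTransform`; decay `k w₋ - u ≤ 2k s^{-1/2} ≤ δ ≤ δ h` cofinitely, as `s → ∞`). -/
theorem lower_comparison_of_barrier {S u V : Site 3 → ℝ}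
    (hS : ∀ x, S x = ∑ i, ((x i : ℤ) : ℝ) ^ 2) {S₀ T p e' A k : ℝ} (hS₀ : 64 ≤ S₀) (hT : S₀ ≤ T)
    (hk : 0 ≤ k)
    (hsuper : ∀ x : Site 3, S₀ / 4 ≤ S x →
      latticeLaplacianZd (fun y => S y ^ (-e') + 1) x ≤ V x * (S x ^ (-e') + 1))
    (hbar : ∀ x : Site 3, S₀ / 4 ≤ S x →
      V x * (S x ^ (-p) + A * S x ^ (-(p + e'))) ≤
        latticeLaplacianZd (fun y => S y ^ (-p) + A * S y ^ (-(p + e'))) x)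
    (hwle : ∀ x : Site 3, S₀ / 4 ≤ S x →
      S x ^ (-p) + A * S x ^ (-(p + e')) ≤ 2 * S x ^ (-(1 / 2 : ℝ)))
    (hsol : ∀ x : Site 3, S₀ / 4 ≤ S x → latticeLaplacianZd u x = V x * u x)
    (hupos : ∀ x : Site 3, S₀ / 4 ≤ S x → 0 < u x)
    (hbdry : ∀ y ∈ zdOuterBoundary {x : Site 3 | T ≤ S x},
      k * (S y ^ (-p) + A * S y ^ (-(p + e'))) ≤ u y)
    {x : Site 3} (hx : T ≤ S x) : k * (S x ^ (-p) + A * S x ^ (-(p + e'))) ≤ u x := by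
  obtain ⟨hEadm, hh1, hpos⟩ := exterior_region_aux hS e' hS₀ hT
  have hStend : Tendsto S cofinite atTop := by simpa only [← hS] using tendsto_sumSq_cofinite
  refine sub_le_super_of_hTransform (d := 3) (by norm_num) (E := {y : Site 3 | T ≤ S y}) (V := V)
    (u := fun y => k * (S y ^ (-p) + A * S y ^ (-(p + e')))) (w := u)
    (h := fun y => S y ^ (-e') + 1) hpos (fun z hz => hsuper z (hEadm z (Or.inl hz))) (fun y hy => ?_)
    (fun y hy => by rw [hsol y (hEadm y (Or.inl hy))]) hbdry (fun δ hδ => ?_) x hx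
  · rw [latticeLaplacianZd_const_mul]
    calc V y * (k * (S y ^ (-p) + A * S y ^ (-(p + e'))))
        = k * (V y * (S y ^ (-p) + A * S y ^ (-(p + e')))) := by ring
      _ ≤ k * latticeLaplacianZd (fun z => S z ^ (-p) + A * S z ^ (-(p + e'))) y :=
          mul_le_mul_of_nonneg_left (hbar y (hEadm y (Or.inl hy))) hk
  · filter_upwards [hStend.eventually (eventually_mul_rpow_neg_le (c := 1 / 2) (by norm_num) (2 * k) hδ)]
      with y hy hyE
    have hy4 : S₀ / 4 ≤ S y := hEadm y (Or.inl hyE)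
    have hkw : k * (S y ^ (-p) + A * S y ^ (-(p + e'))) ≤ k * (2 * S y ^ (-(1 / 2 : ℝ))) :=
      mul_le_mul_of_nonneg_left (hwle y hy4) hk
    have huy := hupos y hy4
    calc k * (S y ^ (-p) + A * S y ^ (-(p + e'))) - u y ≤ δ := by linarith
      _ ≤ δ * (S y ^ (-e') + 1) := le_mul_of_one_le_right hδ.le (hh1 y)

/-- **Exterior comparison for positive solutions of `Δ_{ℤ³} u = V u` under inverse-square telemetry.**
Let `u > 0`, `Δu = Vu` and `|s V - κ| ≤ C √s^{-ε}` hold on `{R ≤ √s}` (`s = ∑ xᵢ²`, `κ ≥ 0`, `ε > 0`)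
and `u → 0` cofinitely; put `p = (1 + √(1+4κ))/4`. Then there are `S₀ ≥ 64` with `R² ≤ S₀/4`, `A > 0`,
`e' > 0` such that for every threshold `T ≥ S₀`, writing `E_T = {T ≤ s}`: (a) `A s^{-e'} ≤ 1/2`
whenever `s ≥ T/4`; (b) for every `K ≥ 0`, if `u ≤ K (s^{-p} - A s^{-(p+e')})` on the lattice
boundary `∂E_T` then on all of `E_T`; (c) for every `k ≥ 0`, if `k (s^{-p} + A s^{-(p+e')}) ≤ u` on
`∂E_T` then on all of `E_T`. The barriers are a supersolution and a subsolution of `Δ - V` for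
`s ≥ S₀/4` (`barrier_arith`) and `h = 1 + s^{-e'}` a positive supersolution (`weight_arith_one_add`). -/
theorem exterior_comparison {κ ε C : ℝ} (hκ : 0 ≤ κ) (hε : 0 < ε) {u V : Site 3 → ℝ} {R : ℝ}
    (hupos : ∀ x : Site 3, R ≤ Real.sqrt (∑ i, ((x i : ℤ) : ℝ) ^ 2) → 0 < u x)
    (heq : ∀ x : Site 3, R ≤ Real.sqrt (∑ i, ((x i : ℤ) : ℝ) ^ 2) →
      (∑ i : Fin 3, (u (x + Pi.single i 1) + u (x - Pi.single i 1))) - 6 * u x = V x * u x)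
    (hVT : ∀ x : Site 3, R ≤ Real.sqrt (∑ i, ((x i : ℤ) : ℝ) ^ 2) →
      |(∑ i, ((x i : ℤ) : ℝ) ^ 2) * V x - κ| ≤ C * Real.sqrt (∑ i, ((x i : ℤ) : ℝ) ^ 2) ^ (-ε))
    (hu0 : Tendsto u cofinite (𝓝 0)) :
    ∃ S₀ A e' : ℝ, 0 < A ∧ 0 < e' ∧ 64 ≤ S₀ ∧ R ^ 2 ≤ S₀ / 4 ∧ ∀ T : ℝ, S₀ ≤ T →
      (∀ x : Site 3, T / 4 ≤ ∑ i, ((x i : ℤ) : ℝ) ^ 2 →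
        A * (∑ i, ((x i : ℤ) : ℝ) ^ 2) ^ (-e') ≤ 1 / 2) ∧
      (∀ K : ℝ, 0 ≤ K →
        (∀ y ∈ zdOuterBoundary {x : Site 3 | T ≤ ∑ i, ((x i : ℤ) : ℝ) ^ 2},
          u y ≤ K * ((∑ i, ((y i : ℤ) : ℝ) ^ 2) ^ (-((1 + Real.sqrt (1 + 4 * κ)) / 4)) -
            A * (∑ i, ((y i : ℤ) : ℝ) ^ 2) ^ (-((1 + Real.sqrt (1 + 4 * κ)) / 4 + e')))) →
        ∀ x : Site 3, T ≤ ∑ i, ((x i : ℤ) : ℝ) ^ 2 →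
          u x ≤ K * ((∑ i, ((x i : ℤ) : ℝ) ^ 2) ^ (-((1 + Real.sqrt (1 + 4 * κ)) / 4)) -
            A * (∑ i, ((x i : ℤ) : ℝ) ^ 2) ^ (-((1 + Real.sqrt (1 + 4 * κ)) / 4 + e')))) ∧
      (∀ k : ℝ, 0 ≤ k →
        (∀ y ∈ zdOuterBoundary {x : Site 3 | T ≤ ∑ i, ((x i : ℤ) : ℝ) ^ 2},
          k * ((∑ i, ((y i : ℤ) : ℝ) ^ 2) ^ (-((1 + Real.sqrt (1 + 4 * κ)) / 4)) +
            A * (∑ i, ((y i : ℤ) : ℝ) ^ 2) ^ (-((1 + Real.sqrt (1 + 4 * κ)) / 4 + e'))) ≤ u y) →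
        ∀ x : Site 3, T ≤ ∑ i, ((x i : ℤ) : ℝ) ^ 2 →
          k * ((∑ i, ((x i : ℤ) : ℝ) ^ 2) ^ (-((1 + Real.sqrt (1 + 4 * κ)) / 4)) +
            A * (∑ i, ((x i : ℤ) : ℝ) ^ 2) ^ (-((1 + Real.sqrt (1 + 4 * κ)) / 4 + e'))) ≤ u x) := by
  obtain ⟨S, hS⟩ : ∃ S : Site 3 → ℝ, ∀ x, S x = ∑ i, ((x i : ℤ) : ℝ) ^ 2 := ⟨_, fun _ => rfl⟩
  simp only [← hS] at hupos heq hVT ⊢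
  have hS0' : ∀ x, 0 ≤ S x := fun x => by rw [hS]; positivity
  -- the telemetry bound in the form `|sV - κ| ≤ C' s^{-e}`, `e = ε/2`, `C' = max C 0 ≥ 0`
  obtain ⟨e, he, heε⟩ : ∃ e : ℝ, 0 < e ∧ ε = 2 * e := ⟨ε / 2, by positivity, by ring⟩
  set C' : ℝ := max C 0 with hC'_def
  have hC' : 0 ≤ C' := le_max_right _ _
  have hVT' : ∀ x : Site 3, R ≤ Real.sqrt (S x) → |S x * V x - κ| ≤ C' * S x ^ (-e) := by
    intro x hx
    have e2 : Real.sqrt (S x) ^ (-ε) = S x ^ (-e) := by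
      rw [Real.sqrt_eq_rpow (S x), ← Real.rpow_mul (hS0' x), heε]; congr 1; ring
    exact ((hVT x hx).trans_eq (by rw [e2])).trans
      (mul_le_mul_of_nonneg_right (le_max_left _ _) (Real.rpow_nonneg (hS0' x) _))
  have hsol : ∀ x : Site 3, R ≤ Real.sqrt (S x) → latticeLaplacianZd u x = V x * u x :=
    fun x hx => by rw [latticeLaplacianZd_three]; exact heq x hx
  -- the exponents and constants (as in `exterior_bounds`)
  set r : ℝ := Real.sqrt (1 + 4 * κ) with hr
  have hr1 : 1 ≤ r := by
    simpa only [Real.sqrt_one] using Real.sqrt_le_sqrt (show (1 : ℝ) ≤ 1 + 4 * κ by linarith)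
  have hrr : r ^ 2 = 1 + 4 * κ := Real.sq_sqrt (by linarith)
  set p : ℝ := (1 + r) / 4 with hp
  have hp2 : 1 / 2 ≤ p := by rw [hp]; linarith
  have hκp : 2 * p * (2 * p - 1) = κ := by rw [hp]; linear_combination (1 / 4 : ℝ) * hrr
  clear_value p r
  obtain ⟨e', he'0, he'e, he'4⟩ : ∃ e' : ℝ, 0 < e' ∧ e' < e ∧ e' ≤ 1 / 8 :=
    ⟨min e (1 / 4) / 2, by positivity, by have := min_le_left e (1 / 4); linarith,
      by have := min_le_right e (1 / 4); linarith⟩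
  obtain ⟨D, hD0, hκq⟩ : ∃ D : ℝ, 0 < D ∧ 2 * (p + e') * (2 * (p + e') - 1) = κ + D :=
    ⟨2 * e' * (4 * p + 2 * e' - 1), mul_pos (by linarith) (by linarith), by rw [← hκp]; ring⟩
  obtain ⟨Kp, hKp0, hLp⟩ := latticeLaplacianZd_rpow_neg (show 0 < p by linarith)
  obtain ⟨Kq, -, hLq⟩ := latticeLaplacianZd_rpow_neg (show 0 < p + e' by linarith)
  obtain ⟨Kt, -, hLt⟩ := latticeLaplacianZd_rpow_neg he'0
  simp only [← hS] at hLp hLq hLt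
  simp only [hκq] at hLq
  simp only [hκp] at hLp
  obtain ⟨A, hA0, hAD⟩ : ∃ A : ℝ, 0 < A ∧ A * D = 4 * (C' + Kp + 1) :=
    ⟨4 * (C' + Kp + 1) / D, by positivity, div_mul_cancel₀ _ hD0.ne'⟩
  have hB0 : 0 < 2 * e' * (1 - 2 * e') / 3 := div_pos (mul_pos (by linarith) (by linarith)) three_pos
  have hev : ∀ᶠ s : ℝ in atTop, 16 ≤ s ∧ (A * Kq * s ^ (-(1 / 2 : ℝ)) ≤ 1 ∧
      (C' * A * s ^ (-e) ≤ 1 ∧ (Kt * s ^ (-(1 / 2 : ℝ)) ≤ 2 * e' * (1 - 2 * e') / 3 ∧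
      (C' * s ^ (-(e - e')) ≤ 2 * e' * (1 - 2 * e') / 3 ∧
      (C' * s ^ (-e) ≤ 2 * e' * (1 - 2 * e') / 3 ∧ A * s ^ (-e') ≤ 1 / 2))))) :=
    (eventually_ge_atTop 16).and ((eventually_mul_rpow_neg_le (by norm_num) _ one_pos).and
      ((eventually_mul_rpow_neg_le he _ one_pos).and
      ((eventually_mul_rpow_neg_le (by norm_num) _ hB0).and
      ((eventually_mul_rpow_neg_le (by linarith) _ hB0).and
      ((eventually_mul_rpow_neg_le he _ hB0).and
      (eventually_mul_rpow_neg_le he'0 _ (by norm_num)))))))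
  obtain ⟨S₁, hS₁⟩ := Filter.eventually_atTop.1 hev
  have hm1 : S₁ ≤ max S₁ (max 16 (R ^ 2)) := le_max_left _ _
  have hm2 : (16 : ℝ) ≤ max S₁ (max 16 (R ^ 2)) := le_max_of_le_right (le_max_left _ _)
  have hm3 : R ^ 2 ≤ max S₁ (max 16 (R ^ 2)) := le_max_of_le_right (le_max_right _ _)
  obtain ⟨S₀, hS₀64, hS₁S₀, hRS₀⟩ : ∃ S₀ : ℝ, 64 ≤ S₀ ∧ S₁ ≤ S₀ / 4 ∧ R ^ 2 ≤ S₀ / 4 :=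
    ⟨4 * max S₁ (max 16 (R ^ 2)), by linarith, by linarith, by linarith⟩
  have adm : ∀ x : Site 3, S₀ / 4 ≤ S x → R ≤ Real.sqrt (S x) ∧ 1 ≤ S x ∧ 16 ≤ S x ∧
      A * S x ^ (-(p + e')) ≤ S x ^ (-p) / 2 ∧ A ≤ S x ^ e' ∧
      A * Kq * S x ^ (-(1 / 2 : ℝ)) ≤ 1 ∧ C' * A * S x ^ (-e) ≤ 1 ∧
      Kt * S x ^ (-(1 / 2 : ℝ)) + C' * S x ^ (e' - e) + C' * S x ^ (-e) ≤ 2 * e' * (1 - 2 * e') ∧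
      A * S x ^ (-e') ≤ 1 / 2 := by
    intro x hx
    obtain ⟨h16, h1, h2, h3, h4, h5, h6⟩ := hS₁ (S x) (hS₁S₀.trans hx)
    have hs0 : 0 < S x := by linarith
    refine ⟨?_, by linarith, h16, ?_, ?_, h1, h2, ?_, h6⟩
    · exact (le_abs_self R).trans
        ((Real.sqrt_sq_eq_abs R).symm.trans_le (Real.sqrt_le_sqrt (by linarith)))
    · have hsplit : S x ^ (-(p + e')) = S x ^ (-e') * S x ^ (-p) := by
        rw [← Real.rpow_add hs0]; congr 1; ring
      rw [hsplit, ← mul_assoc]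
      linarith [mul_le_mul_of_nonneg_right h6 (Real.rpow_nonneg hs0.le (-p))]
    · rw [Real.rpow_neg hs0.le e', ← div_eq_mul_inv, div_le_iff₀ (Real.rpow_pos_of_pos hs0 _)] at h6
      linarith
    · rw [show S x ^ (e' - e) = S x ^ (-(e - e')) by congr 1; ring]
      linarith
  -- facts valid for `s ≥ S₀/4`: the weight, the barriers, `w₊ > 0`, `w₋ ≤ 2 s^{-1/2}`
  have hsuper : ∀ x : Site 3, S₀ / 4 ≤ S x →
      latticeLaplacianZd (fun y => S y ^ (-e') + 1) x ≤ V x * (S x ^ (-e') + 1) := by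
    intro x hx4
    obtain ⟨hxR, hs1, hs16, -, -, -, -, hsm, -⟩ := adm x hx4
    exact (latticeLaplacianZd_add_const (fun y => S y ^ (-e')) 1 x).trans_le
      (weight_arith_one_add hs1 hκ (hLt x hs16) (hVT' x hxR) hsm)
  have hbar : ∀ x : Site 3, S₀ / 4 ≤ S x →
      latticeLaplacianZd (fun y => S y ^ (-p) - A * S y ^ (-(p + e'))) x ≤
          V x * (S x ^ (-p) - A * S x ^ (-(p + e'))) ∧
        V x * (S x ^ (-p) + A * S x ^ (-(p + e'))) ≤
          latticeLaplacianZd (fun y => S y ^ (-p) + A * S y ^ (-(p + e'))) x := by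
    intro x hx4
    obtain ⟨hxR, hs1, hs16, -, hAu, c1, c2, -, -⟩ := adm x hx4
    obtain ⟨hsub, hadd⟩ := latticeLaplacianZd_sub_const_mul (fun y => S y ^ (-p))
      (fun y => S y ^ (-(p + e'))) A x
    rw [hsub, hadd]
    refine barrier_arith hs1 hA0.le hC' hAu (hLp x hs16) (hLq x hs16) (hVT' x hxR) ?_
    have h1 : S x ^ (e' - 1 / 2) ≤ 1 := Real.rpow_le_one_of_one_le_of_nonpos hs1 (by linarith)
    have h2 : S x ^ (e' - e) ≤ 1 := Real.rpow_le_one_of_one_le_of_nonpos hs1 (by linarith)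
    linarith [mul_le_of_le_one_right hKp0 h1, mul_le_of_le_one_right hC' h2]
  have hw : ∀ x : Site 3, S₀ / 4 ≤ S x → 0 < S x ^ (-p) - A * S x ^ (-(p + e')) ∧
      S x ^ (-p) + A * S x ^ (-(p + e')) ≤ 2 * S x ^ (-(1 / 2 : ℝ)) := by
    intro x hx
    obtain ⟨-, hs1, -, hAq, -⟩ := adm x hx
    have h0 : 0 < S x ^ (-p) := Real.rpow_pos_of_pos (by linarith) _
    have h2 : S x ^ (-p) ≤ S x ^ (-(1 / 2 : ℝ)) := Real.rpow_le_rpow_of_exponent_le hs1 (by linarith)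
    constructor <;> linarith
  have hsolE : ∀ x : Site 3, S₀ / 4 ≤ S x → latticeLaplacianZd u x = V x * u x :=
    fun x hx => hsol x (adm x hx).1
  -- the comparison on `E_T = {T ≤ s}`, `T ≥ S₀`
  refine ⟨S₀, A, e', hA0, he'0, hS₀64, hRS₀, fun T hT => ⟨fun x hx => ?_, fun K hK hKb x hxT => ?_,
    fun k hk hkb x hxT => ?_⟩⟩
  · exact (adm x (by linarith)).2.2.2.2.2.2.2.2
  · exact upper_comparison_of_barrier hS hS₀64 hT hK hsuper (fun y hy => (hbar y hy).1)
      (fun y hy => (hw y hy).1) hsolE hu0 hKb hxT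
  · exact lower_comparison_of_barrier hS hS₀64 hT hk hsuper (fun y hy => (hbar y hy).2)
      (fun y hy => (hw y hy).2) hsolE (fun y hy => hupos y (adm y hy).1) hkb hxT

/-- **S1 (a-priori bounds).** Under the hypotheses of the crux, `q(x) = u(x)|x|₂^{α₊}` is pinned
between two positive constants for all but finitely many `x ∈ ℤ³`: barriers
`|x|₂^{−α₊}(1 ± A|x|₂^{−e'})` + the `h`-transform maximum principle on `{|x|₂ ≥ S₀}` with
`h = 1 + B|x|₂^{−2q}` (so that `u → 0` is the decay hypothesis `u = o(h)`). Size L.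
Proof: `exterior_comparison` at `T = S₀`; `M` from `u ≤ M w₊` on the finite shell `∂E ⊆ {S₀/4 ≤ s < S₀}`
(`exists_le_mul_on_finite`), `m = M₂⁻¹` from `w₋ ≤ M₂ u` there (`u > 0` on `{s ≥ S₀/4} ⊆ {R ≤ √s}`);
then `m s^{-p} ≤ u ≤ M s^{-p}` on the cofinite set `{S₀ ≤ s}`, and `√s^{α₊} = s^{p}`. -/
theorem stub_aprioriBounds :
    ∀ κ ε C : ℝ, 0 ≤ κ → 0 < ε → ∀ (u V : Literature.Probability.LatticeModels.Site 3 → ℝ) (R : ℝ), (∀ x : Literature.Probability.LatticeModels.Site 3, R ≤ Real.sqrt (∑ i, ((x i : ℝ)) ^ 2) → 0 < u x) → (∀ x : Literature.Probability.LatticeModels.Site 3, R ≤ Real.sqrt (∑ i, ((x i : ℝ)) ^ 2) → (∑ i : Fin 3, (u (x + Pi.single i 1) + u (x - Pi.single i 1))) - 6 * u x = V x * u x) → (∀ x : Literature.Probability.LatticeModels.Site 3, R ≤ Real.sqrt (∑ i, ((x i : ℝ)) ^ 2) → |(∑ i, ((x i : ℝ)) ^ 2) * V x - κ| ≤ C *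 Real.sqrt (∑ i, ((x i : ℝ)) ^ 2) ^ (-ε)) → Filter.Tendsto u Filter.cofinite (nhds 0) → ∃ m M : ℝ, 0 < m ∧ ∀ᶠ x : Literature.Probability.LatticeModels.Site 3 in Filter.cofinite, m ≤ u x * Real.sqrt (∑ i, ((x i : ℝ)) ^ 2) ^ ((1 + Real.sqrt (1 + 4 * κ)) / 2) ∧ u x * Real.sqrt (∑ i, ((x i : ℝ)) ^ 2) ^ ((1 + Real.sqrt (1 + 4 * κ)) / 2) ≤ M := by
  intro κ ε C hκ hε u V R hupos heq hVT hu0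
  obtain ⟨S₀, A, e', hA0, -, hS₀64, hRS₀, hcomp⟩ := exterior_comparison hκ hε hupos heq hVT hu0
  obtain ⟨ha, hb, hc⟩ := hcomp S₀ le_rfl
  obtain ⟨S, hS⟩ : ∃ S : Site 3 → ℝ, ∀ x, S x = ∑ i, ((x i : ℤ) : ℝ) ^ 2 := ⟨_, fun _ => rfl⟩
  have hS0' : ∀ x, 0 ≤ S x := fun x => by rw [hS]; positivity
  have hbdryS : ∀ y ∈ zdOuterBoundary {x : Site 3 | S₀ ≤ ∑ i, ((x i : ℤ) : ℝ) ^ 2},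
      S₀ / 4 ≤ S y ∧ S y < S₀ := fun y hy => by
    have h := sumSq_of_mem_zdOuterBoundary hS₀64 hy
    rwa [← hS] at h
  simp only [← hS] at hupos ha hb hc hbdryS ⊢
  have hexp : ∀ x, Real.sqrt (S x) ^ ((1 + Real.sqrt (1 + 4 * κ)) / 2) =
      S x ^ ((1 + Real.sqrt (1 + 4 * κ)) / 4) := fun x => by
    rw [Real.sqrt_eq_rpow (S x), ← Real.rpow_mul (hS0' x)]; congr 1; ring
  simp only [hexp]
  generalize (1 + Real.sqrt (1 + 4 * κ)) / 4 = p at hb hc ⊢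
  have hF : {y : Site 3 | S y ≤ S₀}.Finite := by simpa only [← hS] using finite_sumSq_le S₀
  obtain ⟨M, hM0, hM⟩ :=
    exists_le_mul_on_finite hF u (fun y => S y ^ (-p) - A * S y ^ (-(p + e')))
  obtain ⟨M₂, hM₂0, hM₂⟩ :=
    exists_le_mul_on_finite hF (fun y => S y ^ (-p) + A * S y ^ (-(p + e'))) u
  -- on `{S₀/4 ≤ s}`: `0 ≤ A s^{-(p+e')} ≤ s^{-p}/2` and `R ≤ √s`
  have hw : ∀ y : Site 3, S₀ / 4 ≤ S y → 0 < S y ^ (-p) ∧ 0 ≤ A * S y ^ (-(p + e')) ∧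
      A * S y ^ (-(p + e')) ≤ S y ^ (-p) / 2 ∧ R ≤ Real.sqrt (S y) := fun y hy => by
    have hs0 : 0 < S y := by linarith
    have h0 : 0 < S y ^ (-p) := Real.rpow_pos_of_pos hs0 _
    have hA2 := ha y hy
    have hsplit : S y ^ (-(p + e')) = S y ^ (-e') * S y ^ (-p) := by
      rw [← Real.rpow_add hs0]; congr 1; ring
    refine ⟨h0, ?_, ?_, (le_abs_self R).trans
      ((Real.sqrt_sq_eq_abs R).symm.trans_le (Real.sqrt_le_sqrt (by linarith)))⟩
    · positivity
    · rw [hsplit, ← mul_assoc]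
      nlinarith
  have hupper := hb M hM0.le fun y hy => by
    obtain ⟨hy4, hyS⟩ := hbdryS y hy
    obtain ⟨h0, -, h2, -⟩ := hw y hy4
    exact hM y hyS.le (by linarith)
  have hlower := hc M₂⁻¹ (inv_nonneg.2 hM₂0.le) fun y hy => by
    obtain ⟨hy4, hyS⟩ := hbdryS y hy
    rw [inv_mul_le_iff₀ hM₂0]
    exact hM₂ y hyS.le (hupos y (hw y hy4).2.2.2)
  refine ⟨M₂⁻¹, M, inv_pos.2 hM₂0, ?_⟩
  have hStend : Tendsto S cofinite atTop := by simpa only [← hS] using tendsto_sumSq_cofinite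
  filter_upwards [hStend.eventually_ge_atTop S₀] with x hx
  have hs0 : 0 < S x := by linarith
  have hsp : 0 < S x ^ p := Real.rpow_pos_of_pos hs0 _
  have hneg : S x ^ (-p) = (S x ^ p)⁻¹ := Real.rpow_neg hs0.le p
  obtain ⟨-, h1, -, -⟩ := hw x (by linarith)
  have hlo : M₂⁻¹ * S x ^ (-p) ≤ u x := by
    have h := hlower x hx
    have : 0 ≤ M₂⁻¹ * (A * S x ^ (-(p + e'))) := mul_nonneg (inv_nonneg.2 hM₂0.le) h1
    linarith
  have hup : u x ≤ M * S x ^ (-p) := by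
    have h := hupper x hx
    have : 0 ≤ M * (A * S x ^ (-(p + e'))) := mul_nonneg hM0.le h1
    linarith
  rw [hneg, ← div_eq_mul_inv, div_le_iff₀ hsp] at hlo
  rw [hneg, ← div_eq_mul_inv, le_div_iff₀ hsp] at hup
  exact ⟨hlo, hup⟩

end Summit.CriticalPhenomena.Ising3DConformalLimit.Theorems.PositiveSolutionAsymptotics
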